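import Summits.QuantumAdvantage.QuantumAdvantage.Theses.MobiusLadder
import Literature.NumberTheory.Sieve.MoebiusWalshCircuitsAC0Holds
import HarnessLib

/-!
# Route MobiusLadder, support item `LiouvilleOrthogonalAC0` (stmt-QuantumAdvantage-1394) — proved

"Möbius randomness for `AC⁰`" in Liouville form: for every depth `d`, size polynomial `p` and
`ε > 0`, for all large `n`, every circuit `C` on the `n` binary digits over `acBasis`
(`∧`, `∨` of any fan-in, `¬` free in `acDepth`) with `acDepth ≤ d` and `size ≤ p(n)` satisfies
`|Σ_{N<2ⁿ} λ(N) · sgn (C(bits N))| ≤ ε · 2ⁿ`.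

This is B. Green, *On (not) computing the Möbius function using bounded depth circuits*, Combin.
Probab. Comput. **21** (2012) 942–951, Theorem 1, in the `λ`-version of the §1 remark ("All of the
results in this paper hold equally well for the Liouville function"), in the qualitative (`ε`)
form the class glue `LiouvilleNotAC0` consumes. The whole proof is in the tree: the named fact
`Literature.NumberTheory.Sieve.green_liouville_AC0` is verbatim this item's statement and is
DISCHARGED there (`Literature.NumberTheory.Sieve.green_liouville_AC0_holds`: Green's Proposition 1
for `λ` — Kátai's argument, the Harman–Kátai lemma, the minor-arc bound and characters to `2`-power
moduli, `Literature.NumberTheory.LFunctions.green_liouville_fourierWalsh_holds` — combined with the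
§2 deduction through Tal's Fourier-tail bounds for `acBasis` circuits with negations pushed to the
inputs, `Literature.NumberTheory.Sieve.green_liouville_AC0_of_fourierWalsh`). This file only
records that the route decl is that proved fact.

## References

* B. Green, Combin. Probab. Comput. 21 (2012) 942–951 (arXiv:1103.4991), Theorem 1, Proposition 1,
  §1 (remark on `λ`), §2. [Green2012]
* A. Tal, *Tight bounds on the Fourier spectrum of AC⁰*, CCC 2017, Theorem 3.6. [Tal2017]
-/

set_option linter.dupNamespace false -- D-0017: single-problem summit ⇒ `QuantumAdvantage.QuantumAdvantage` by design

namespace Summit.QuantumAdvantage.QuantumAdvantage.Theorems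

/-- **Route MobiusLadder, item `LiouvilleOrthogonalAC0` (Möbius randomness for `AC⁰`, Liouville
form) — PROVED.** For every `d`, every `p : Polynomial ℕ` and every `ε > 0`, eventually in `n`,
every circuit `C : Circuit (Fin n)` over `acBasis` with `C.acDepth ≤ d` and `C.size ≤ p.eval n` has
`|∑_{N < 2^n} λ(N) · sgn (C.eval (i ↦ N.testBit i))| ≤ ε · 2^n`. Proof: this is the tree's proved
form of Green 2012, Theorem 1 for `λ`, `Literature.NumberTheory.Sieve.green_liouville_AC0_holds`
(statement `Literature.NumberTheory.Sieve.green_liouville_AC0`, identical to the route decl after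
unfolding). [cite: Green2012, Theorem 1 and §1 (remark on λ)] -/
theorem LiouvilleOrthogonalAC0_proof :
    Summit.QuantumAdvantage.QuantumAdvantage.Theses.MobiusLadder.LiouvilleOrthogonalAC0 := by
  unfold Summit.QuantumAdvantage.QuantumAdvantage.Theses.MobiusLadder.LiouvilleOrthogonalAC0
  exact Literature.NumberTheory.Sieve.green_liouville_AC0_holds

end Summit.QuantumAdvantage.QuantumAdvantage.Theorems
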